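import Mathlib

/-!
# Route `SymPencil` — the ORTHOGONAL COMPLEMENT of a non-degenerate `4`-frame in `≤ 5` weighted
# squares contains no isotropic vector (`--supports` stmt-ValiantsHypothesis-5674
# `SdcSuperquadratic`; (11,5) column of the size-28 table, the joint-FIVE bricks; rung currency
# only — nothing here bears on `VP ≠ VNP`)

The joint-FOUR bricks of the size-`27` cell `(11,5,4)` (`…CrossPairNoJoint`, `…RowPairNoJoint`,
`…RowPairSkewNoJoint`, `…RowPairSumNoJoint`) end in a matrix step: four test vectors `U_i` whose
Gram matrix `𝔅 D 𝔅ᵀ = ½ J` is invertible make the `4 × 4` matrix `𝔅 = (β_k(U_i, y))` invertible,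
so a vector `z` orthogonal to every `U_i` has `c_k β_k(z, y) = 0`.  With FIVE squares `𝔅` is
`4 × 5` and invertibility is gone; this file supplies the replacement (`eq_zero_of_orth_rows_isotropic`):
if `b₀, …, b₃ ∈ K^ι` (`|ι| ≤ 5`) have an invertible weighted Gram matrix
`G_{ij} = Σ_k c_k b_{ik} b_{jk}`, and `w ∈ K^ι` is weighted-orthogonal to every `b_i` AND weighted
ISOTROPIC (`Σ_k c_k w_k² = 0` — in the bricks: `z` is `Q_t`-isotropic), then `c_k w_k = 0` for all
`k`.  Proof: the `b_i` are independent (Gram invertible); if `w` is in their span, `G a = 0` forces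
`w = 0`; otherwise `b₀, …, b₃, w` is a basis of `K^ι` (`|ι| ≤ 5`) on which the functional
`x ↦ Σ_k c_k w_k x_k` vanishes, so it vanishes on every unit vector.  No non-degeneracy of the
weights is needed.

Honest framing: linear algebra for the five-square bricks; no cell closes here; nothing about the
determinantal complexity of `per_4` is claimed; stmt-5674 `SdcSuperquadratic` OPEN; `VP ≠ VNP`
not moved.  No definitions, no named facts. [folklore]
-/

noncomputable section

-- single-conjunct layout: Sub = Summit, duplicated namespace component intended
set_option linter.dupNamespace false

namespace Summit.ValiantsHypothesis.ValiantsHypothesis.Theorems.SymPencilPerFourIsotropicComplement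

open Matrix Finset Module

universe u v

variable {K : Type u} [Field K]

/-- **Rows with an invertible weighted Gram matrix are linearly independent.** [folklore] -/
theorem linearIndependent_of_gram_mul_eq_one {ι : Type v} [Fintype ι] (c : ι → K)
    (b : Fin 4 → ι → K) (G' : Matrix (Fin 4) (Fin 4) K)
    (hG : (Matrix.of fun i j : Fin 4 => ∑ k, c k * b i k * b j k) * G' = 1) :
    LinearIndependent K b := by
  classical
  set G : Matrix (Fin 4) (Fin 4) K := Matrix.of fun i j : Fin 4 => ∑ k, c k * b i k * b j k with hGdef
  rw [Fintype.linearIndependent_iff]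
  intro a ha i
  -- `a ᵥ* G = 0`
  have hvec : a ᵥ* G = 0 := by
    funext j
    rw [Matrix.vecMul, dotProduct, Pi.zero_apply]
    have hsum : ∑ i, a i * G i j = ∑ k, c k * (∑ i, a i * b i k) * b j k := by
      simp only [hGdef, Matrix.of_apply, Finset.mul_sum, Finset.sum_mul]
      rw [Finset.sum_comm]
      exact Finset.sum_congr rfl fun k _ => Finset.sum_congr rfl fun i _ => by ring
    rw [hsum]
    refine Finset.sum_eq_zero fun k _ => ?_
    have hk : (∑ i, a i • b i) k = 0 := by rw [ha]; rfl
    rw [Finset.sum_apply] at hk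
    simp only [Pi.smul_apply, smul_eq_mul] at hk
    rw [hk]; ring
  have h : a ᵥ* (G * G') = a := by rw [hG, Matrix.vecMul_one]
  rw [← Matrix.vecMul_vecMul, hvec, Matrix.zero_vecMul] at h
  rw [← h]; rfl

/-- ★ **An isotropic vector orthogonal to a non-degenerate `4`-frame in `≤ 5` weighted squares is
killed by the weights**: `c_k w_k = 0` for every `k`. [folklore] -/
theorem eq_zero_of_orth_rows_isotropic {ι : Type v} [Fintype ι] [DecidableEq ι]
    (hι : Fintype.card ι ≤ 5) (c : ι → K) (b : Fin 4 → ι → K) (G' : Matrix (Fin 4) (Fin 4) K)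
    (hG : (Matrix.of fun i j : Fin 4 => ∑ k, c k * b i k * b j k) * G' = 1)
    (w : ι → K) (hw : ∀ i, ∑ k, c k * b i k * w k = 0) (hiso : ∑ k, c k * w k * w k = 0) :
    ∀ k, c k * w k = 0 := by
  classical
  set G : Matrix (Fin 4) (Fin 4) K := Matrix.of fun i j : Fin 4 => ∑ k, c k * b i k * b j k with hGdef
  have hind : LinearIndependent K b := linearIndependent_of_gram_mul_eq_one c b G' hG
  by_cases hws : w ∈ Submodule.span K (Set.range b)
  · -- `w = Σ a_i b_i` with `G a = 0`, hence `a = 0` and `w = 0`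
    obtain ⟨a, ha⟩ := (Submodule.mem_span_range_iff_exists_fun K).1 hws
    have hwk : ∀ k, w k = ∑ i, a i * b i k := fun k => by
      rw [← ha, Finset.sum_apply]
      simp only [Pi.smul_apply, smul_eq_mul]
    have hGa : G *ᵥ a = 0 := by
      funext j
      rw [Matrix.mulVec, dotProduct, Pi.zero_apply]
      have hsum : ∑ i, G j i * a i = ∑ k, c k * b j k * w k := by
        simp only [hGdef, Matrix.of_apply, hwk, Finset.mul_sum, Finset.sum_mul]
        rw [Finset.sum_comm]
        exact Finset.sum_congr rfl fun k _ => Finset.sum_congr rfl fun i _ => by ring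
      rw [hsum, hw j]
    have hG'G : G' * G = 1 := mul_eq_one_comm.1 hG
    have ha0 : a = 0 := by
      have h : (G' * G) *ᵥ a = a := by rw [hG'G, Matrix.one_mulVec]
      rw [← Matrix.mulVec_mulVec, hGa, Matrix.mulVec_zero] at h
      exact h.symm
    intro k
    rw [hwk k]
    simp [ha0]
  · -- `b₀, …, b₃, w` is a basis of `K^ι`; the functional `x ↦ Σ c_k w_k x_k` vanishes on it
    have hind5 : LinearIndependent K (Fin.snoc b w : Fin 5 → ι → K) :=
      linearIndependent_finSnoc.2 ⟨hind, hws⟩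
    have hcard : Fintype.card (Fin 5) = finrank K (ι → K) := by
      have h1 := hind5.fintype_card_le_finrank
      rw [finrank_fintype_fun_eq_card] at h1 ⊢
      simp only [Fintype.card_fin] at h1 ⊢
      omega
    have hspan := hind5.span_eq_top_of_card_eq_finrank hcard
    let f : (ι → K) →ₗ[K] K :=
      { toFun := fun x => ∑ k, c k * w k * x k
        map_add' := fun x y => by
          simp only [Pi.add_apply, mul_add, Finset.sum_add_distrib]
        map_smul' := fun s x => by
          simp only [Pi.smul_apply, smul_eq_mul, RingHom.id_apply, Finset.mul_sum]
          exact Finset.sum_congr rfl fun k _ => by ring }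
    have hf : ∀ x, f x = ∑ k, c k * w k * x k := fun _ => rfl
    have hfgen : ∀ m : Fin 5, f ((Fin.snoc b w : Fin 5 → ι → K) m) = 0 := by
      intro m
      rw [hf]
      refine Fin.lastCases ?_ (fun i => ?_) m
      · rw [Fin.snoc_last]; exact hiso
      · rw [Fin.snoc_castSucc, ← hw i]
        exact Finset.sum_congr rfl fun k _ => by ring
    have hf0 : f = 0 := by
      apply LinearMap.ext_on_range hspan
      intro m; rw [hfgen m, LinearMap.zero_apply]
    intro k
    have h := LinearMap.congr_fun hf0 (Pi.single k 1)
    rw [hf, LinearMap.zero_apply, Finset.sum_eq_single k (fun k' _ hk' => by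
      rw [Pi.single_eq_of_ne hk', mul_zero]) (fun h => absurd (Finset.mem_univ k) h),
      Pi.single_eq_same, mul_one] at h
    exact h

end Summit.ValiantsHypothesis.ValiantsHypothesis.Theorems.SymPencilPerFourIsotropicComplement

end
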